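import Mathlib
import HarnessLib

/-!
# The Riemann–Stieltjes integral: sums, elementary properties, reduction to a weighted Riemann integral (Davis–Rabinowitz 1984, Sect. 1.6.5)

[cite: DavisRabinowitz1984, Sect. 1.6.5 (1.6.5.1)-(1.6.5.3), (1.6.5.5)-(1.6.5.12), (1.6.5.15)]

P. J. Davis and P. Rabinowitz, *Methods of Numerical Integration*, 2nd ed., Academic Press 1984,
Sect. 1.6.5 *The Riemann–Stieltjes Integral*.

Loc. cit.: take a partition `a = x_0 < x_1 < ⋯ < x_n = b` (1.6.5.1) and tags `x_{k-1} ≤ ξ_k ≤ x_k`;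
the Riemann–Stieltjes sum of `f` with respect to the integrator `g` is
`S_n = Σ_{k=1}^{n} f(ξ_k) (g(x_k) - g(x_{k-1}))` (1.6.5.3); "if `g(x) ≡ x`, these sums reduce to
ordinary Riemann sums"; if for any sequence of partitions with norm `Δ = max_k (x_k - x_{k-1}) → 0`
and any tags the sums have a common limit `S`, one writes `S = ∫_a^b f dg` (1.6.5.4).  The text then
lists: linearity in `f` (1.6.5.5) and in `g` (1.6.5.6), additivity over `[a, c] ∪ [c, b]` (1.6.5.7),
monotonicity (1.6.5.8), the bound `|∫ f dg| ≤ (sup |f|) V_a^b(g)` (1.6.5.9), the reduction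
`∫_a^b f dg = ∫_a^b f g' dx` for `f ∈ C[a, b]`, `g ∈ C¹[a, b]` (1.6.5.10), the weighted case
`g(x) = ∫_a^x w(t) dt ⇒ ∫ f dg = ∫ w f dx` (1.6.5.11), integration by parts
`∫_a^b f dg = f(b) g(b) - f(a) g(a) - ∫_a^b g df` (1.6.5.12), and the evaluation for a step
integrator `∫ f dg = Σ u_k f(t_k)` (1.6.5.15).

## What is formalised

Partitions are indexed by `ℕ`: points `x : ℕ → ℝ` (with `x 0 = a`, `x n = b`) and tags `ξ : ℕ → ℝ`;
`rsSum f g n x ξ = Σ_{k<n} f(ξ_k) (g(x_{k+1}) - g(x_k))` is (1.6.5.3) (0-based).  At the level of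
the sums, exactly (no limits): the Riemann-sum special case `g = id`, linearity (1.6.5.5)/(1.6.5.6),
additivity (1.6.5.7) (concatenated partitions), monotonicity (1.6.5.8) for a nondecreasing integrator,
the bound (1.6.5.9) `|S_n| ≤ M Σ_k |g(x_{k+1}) - g(x_k)|` (the sum is `≤ V_a^b(g)`), Abel's
summation-by-parts identity behind (1.6.5.12) (`rsSum_parts`: the sum for `∫ f dg` equals
`f(b) g(b) - f(a) g(a)` minus the Riemann–Stieltjes sum for `∫ g df` over the partition formed by
the tags, tagged by the old points), and the step-integrator evaluation (1.6.5.15) for an integrator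
that is constant across every cell but one.  With limits: for the UNIFORM partitions
`x_k = a + k (b - a)/n` and arbitrary (n-dependent) tags, `f` continuous on `[a, b]` and `g` with a
continuous derivative `g'` on `[a, b]`, the sums converge to `∫_a^b f g'` (1.6.5.10)
(`tendsto_rsSum_uniform`, via the explicit modulus estimate `abs_rsSum_sub_integral_le`), and the
weighted case (1.6.5.11) (`tendsto_rsSum_primitive`).  The existence theory for general `g ∈ BV`
(1.6.5.4) and the mean-value theorems (1.6.5.13)-(1.6.5.14) are not formalised here.

AI-produced formalisation (H21 engines group, seat eng-quad-3, 2026-08-25); no facts, no axioms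
beyond Mathlib's, no `sorry`.
-/

open Real Finset Filter Topology MeasureTheory intervalIntegral Set

open scoped Interval

namespace Literature.Analysis.Quadrature

/-! ## Riemann–Stieltjes sums (1.6.5.3) -/

/-- The Riemann–Stieltjes sum `S_n = Σ_{k<n} f(ξ_k) (g(x_{k+1}) - g(x_k))` of `f` with respect to the
integrator `g` over the partition points `x_0, …, x_n` with tags `ξ_k ∈ [x_k, x_{k+1}]` (0-based form
of (1.6.5.3)). [cite: DavisRabinowitz1984, Sect. 1.6.5 (1.6.5.3)] -/
def rsSum (f g : ℝ → ℝ) (n : ℕ) (x ξ : ℕ → ℝ) : ℝ :=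
  ∑ k ∈ Finset.range n, f (ξ k) * (g (x (k + 1)) - g (x k))

/-- "If `g(x) ≡ x`, these sums reduce to ordinary Riemann sums."
[cite: DavisRabinowitz1984, Sect. 1.6.5 (1.6.5.3)] -/
theorem rsSum_id (f : ℝ → ℝ) (n : ℕ) (x ξ : ℕ → ℝ) :
    rsSum f id n x ξ = ∑ k ∈ Finset.range n, f (ξ k) * (x (k + 1) - x k) := rfl

/-- (1.6.5.5): linearity in the integrand, `∫ (c₁ f₁ + c₂ f₂) dg = c₁ ∫ f₁ dg + c₂ ∫ f₂ dg`, at the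
level of the sums. [cite: DavisRabinowitz1984, Sect. 1.6.5 (1.6.5.5)] -/
theorem rsSum_linear_left (c₁ c₂ : ℝ) (f₁ f₂ g : ℝ → ℝ) (n : ℕ) (x ξ : ℕ → ℝ) :
    rsSum (fun t => c₁ * f₁ t + c₂ * f₂ t) g n x ξ = c₁ * rsSum f₁ g n x ξ + c₂ * rsSum f₂ g n x ξ := by
  simp only [rsSum, Finset.mul_sum, ← Finset.sum_add_distrib]
  refine Finset.sum_congr rfl fun k _ => ?_
  ring

/-- (1.6.5.6): linearity in the integrator, `∫ f d(g + h) = ∫ f dg + ∫ f dh`, at the level of the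
sums. [cite: DavisRabinowitz1984, Sect. 1.6.5 (1.6.5.6)] -/
theorem rsSum_add_right (f g h : ℝ → ℝ) (n : ℕ) (x ξ : ℕ → ℝ) :
    rsSum f (fun t => g t + h t) n x ξ = rsSum f g n x ξ + rsSum f h n x ξ := by
  simp only [rsSum, ← Finset.sum_add_distrib]
  refine Finset.sum_congr rfl fun k _ => ?_
  ring

/-- (1.6.5.7): additivity `∫_a^b = ∫_a^c + ∫_c^b` at the level of the sums — the sum over the
concatenation of a partition of `[a, c]` with `n` cells and one of `[c, b]` with `m` cells (points
and tags shifted by `n`) splits accordingly. [cite: DavisRabinowitz1984, Sect. 1.6.5 (1.6.5.7)] -/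
theorem rsSum_append (f g : ℝ → ℝ) (n m : ℕ) (x ξ : ℕ → ℝ) :
    rsSum f g (n + m) x ξ = rsSum f g n x ξ + rsSum f g m (fun k => x (n + k)) (fun k => ξ (n + k)) := by
  simp only [rsSum, Finset.sum_range_add, Nat.add_assoc]

/-- (1.6.5.8): if `f₁ ≤ f₂` at the tags and `g` is nondecreasing along the partition points, then
`S_n(f₁) ≤ S_n(f₂)`. [cite: DavisRabinowitz1984, Sect. 1.6.5 (1.6.5.8)] -/
theorem rsSum_mono (f₁ f₂ g : ℝ → ℝ) (n : ℕ) (x ξ : ℕ → ℝ)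
    (hf : ∀ k < n, f₁ (ξ k) ≤ f₂ (ξ k)) (hg : ∀ k < n, g (x k) ≤ g (x (k + 1))) :
    rsSum f₁ g n x ξ ≤ rsSum f₂ g n x ξ := by
  unfold rsSum
  refine Finset.sum_le_sum fun k hk => ?_
  rw [Finset.mem_range] at hk
  exact mul_le_mul_of_nonneg_right (hf k hk) (sub_nonneg.mpr (hg k hk))

/-- (1.6.5.9) at the level of the sums: if `|f| ≤ M` at the tags then
`|S_n| ≤ M Σ_k |g(x_{k+1}) - g(x_k)|` (and the latter sum is at most the variation `V_a^b(g)` of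
(1.6.5.2)). [cite: DavisRabinowitz1984, Sect. 1.6.5 (1.6.5.9)] -/
theorem abs_rsSum_le (f g : ℝ → ℝ) (n : ℕ) (x ξ : ℕ → ℝ) {M : ℝ}
    (hf : ∀ k < n, |f (ξ k)| ≤ M) :
    |rsSum f g n x ξ| ≤ M * ∑ k ∈ Finset.range n, |g (x (k + 1)) - g (x k)| := by
  unfold rsSum
  refine (Finset.abs_sum_le_sum_abs _ _).trans ?_
  rw [Finset.mul_sum]
  refine Finset.sum_le_sum fun k hk => ?_
  rw [Finset.mem_range] at hk
  rw [abs_mul]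
  exact mul_le_mul_of_nonneg_right (hf k hk) (abs_nonneg _)

/-- For a nondecreasing integrator the sum `Σ_k |g(x_{k+1}) - g(x_k)|` telescopes to
`g(x_n) - g(x_0)` (`= V_a^b(g)` for monotone `g`). [cite: DavisRabinowitz1984, Sect. 1.6.5 (1.6.5.2)] -/
theorem sum_abs_sub_eq_of_monotone (g : ℝ → ℝ) (n : ℕ) (x : ℕ → ℝ)
    (hg : ∀ k < n, g (x k) ≤ g (x (k + 1))) :
    ∑ k ∈ Finset.range n, |g (x (k + 1)) - g (x k)| = g (x n) - g (x 0) := by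
  rw [← Finset.sum_range_sub (fun k => g (x k)) n]
  refine Finset.sum_congr rfl fun k hk => ?_
  rw [Finset.mem_range] at hk
  exact abs_of_nonneg (sub_nonneg.mpr (hg k hk))

/-! ## Integration by parts (1.6.5.12): Abel's identity -/

/-- The partition `a, ξ_0, …, ξ_{n-1}, b` formed by the tags (the partition of the integration by
parts (1.6.5.12)). [cite: DavisRabinowitz1984, Sect. 1.6.5 (1.6.5.12)] -/
def tagPartition (a b : ℝ) (n : ℕ) (ξ : ℕ → ℝ) (k : ℕ) : ℝ :=
  if k = 0 then a else if k ≤ n then ξ (k - 1) else b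

/-- First point of the tag partition: `a`. [cite: DavisRabinowitz1984, Sect. 1.6.5 (1.6.5.12)] -/
@[simp] theorem tagPartition_zero (a b : ℝ) (n : ℕ) (ξ : ℕ → ℝ) : tagPartition a b n ξ 0 = a := by
  simp [tagPartition]

/-- Interior points of the tag partition: `ξ_k`. [cite: DavisRabinowitz1984, Sect. 1.6.5 (1.6.5.12)] -/
theorem tagPartition_succ_of_lt (a b : ℝ) {n k : ℕ} (ξ : ℕ → ℝ) (hk : k < n) :
    tagPartition a b n ξ (k + 1) = ξ k := by
  simp [tagPartition, Nat.succ_le_of_lt hk]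

/-- Last point of the tag partition: `b`. [cite: DavisRabinowitz1984, Sect. 1.6.5 (1.6.5.12)] -/
@[simp] theorem tagPartition_succ_self (a b : ℝ) (n : ℕ) (ξ : ℕ → ℝ) :
    tagPartition a b n ξ (n + 1) = b := by
  simp [tagPartition]

/-- (1.6.5.12), summation by parts (Abel): with `x_0 = a`, `x_n = b`, the Riemann–Stieltjes sum for
`∫_a^b f dg` over `x` with tags `ξ` equals `f(b) g(b) - f(a) g(a)` minus the Riemann–Stieltjes sum
for `∫_a^b g df` over the partition `a, ξ_0, …, ξ_{n-1}, b` formed by the tags, tagged by the points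
`x_0, …, x_n` (each `x_k` lies in `[ξ_{k-1}, ξ_k]`).  Passing to the limit gives the
integration-by-parts formula. [cite: DavisRabinowitz1984, Sect. 1.6.5 (1.6.5.12)] -/
theorem rsSum_parts (f g : ℝ → ℝ) {a b : ℝ} (n : ℕ) (x ξ : ℕ → ℝ) (h0 : x 0 = a) (hn : x n = b) :
    rsSum f g n x ξ = f b * g b - f a * g a - rsSum g f (n + 1) (tagPartition a b n ξ) x := by
  induction n generalizing b with
  | zero =>
    subst hn; subst h0
    simp [rsSum, tagPartition]
  | succ n ih =>
    -- peel off the last cell of both sums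
    have ih' := ih (b := x n) rfl
    rw [rsSum, Finset.sum_range_succ, ← rsSum, ih']
    rw [rsSum, rsSum, Finset.sum_range_succ (n := n + 1), Finset.sum_range_succ (n := n)]
    rw [Finset.sum_range_succ (n := n)]
    simp only [tagPartition_succ_self, tagPartition_succ_of_lt _ _ _ (Nat.lt_succ_self n)]
    have hinner : ∀ k ∈ Finset.range n,
        g (x k) * (f (tagPartition a (x n) n ξ (k + 1)) - f (tagPartition a (x n) n ξ k)) =
        g (x k) * (f (tagPartition a b (n + 1) ξ (k + 1)) - f (tagPartition a b (n + 1) ξ k)) := by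
      intro k hk
      rw [Finset.mem_range] at hk
      rw [tagPartition_succ_of_lt _ _ _ hk, tagPartition_succ_of_lt _ _ _ (Nat.lt_succ_of_lt hk)]
      rcases Nat.eq_zero_or_pos k with rfl | hpos
      · simp
      · obtain ⟨j, rfl⟩ := Nat.exists_eq_succ_of_ne_zero hpos.ne'
        rw [tagPartition_succ_of_lt _ _ _ (Nat.lt_of_succ_lt hk),
          tagPartition_succ_of_lt _ _ _ (Nat.lt_succ_of_lt (Nat.lt_of_succ_lt hk))]
    rw [Finset.sum_congr rfl hinner, hn]
    -- the `k = n` terms of the inner sums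
    rcases Nat.eq_zero_or_pos n with rfl | hpos
    · simp [tagPartition]; ring
    · obtain ⟨j, rfl⟩ := Nat.exists_eq_succ_of_ne_zero hpos.ne'
      rw [tagPartition_succ_of_lt _ _ _ (Nat.lt_succ_self j),
        tagPartition_succ_of_lt _ _ _ (Nat.lt_succ_of_lt (Nat.lt_succ_self j))]
      ring

/-! ## Step integrators (1.6.5.15) -/

/-- (1.6.5.15), one jump: if the integrator takes equal values at the two ends of every cell except the
`j`-th, the Riemann–Stieltjes sum is `f(ξ_j) · (g(x_{j+1}) - g(x_j))` — the jump times the value of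
`f` at the tag of that cell (summing over the jumps gives `Σ u_k f(t_k)`).
[cite: DavisRabinowitz1984, Sect. 1.6.5 (1.6.5.15)] -/
theorem rsSum_single_jump (f g : ℝ → ℝ) {n j : ℕ} (x ξ : ℕ → ℝ) (hj : j < n)
    (hg : ∀ k < n, k ≠ j → g (x (k + 1)) = g (x k)) :
    rsSum f g n x ξ = f (ξ j) * (g (x (j + 1)) - g (x j)) := by
  unfold rsSum
  rw [Finset.sum_eq_single j]
  · intro k hk hkj
    rw [Finset.mem_range] at hk
    rw [hg k hk hkj, sub_self, mul_zero]
  · intro h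
    exact absurd (Finset.mem_range.mpr hj) h

/-! ## Uniform partitions and the reduction `∫ f dg = ∫ f g' dx` (1.6.5.10)-(1.6.5.11) -/

/-- The uniform partition points `x_k = a + k (b - a)/n` of `[a, b]`.
[cite: DavisRabinowitz1984, Sect. 1.6.5 (1.6.5.1)] -/
noncomputable def unifPt (a b : ℝ) (n k : ℕ) : ℝ := a + k * ((b - a) / n)

/-- `x_0 = a` (1.6.5.1). [cite: DavisRabinowitz1984, Sect. 1.6.5 (1.6.5.1)] -/
@[simp] theorem unifPt_zero (a b : ℝ) (n : ℕ) : unifPt a b n 0 = a := by simp [unifPt]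

/-- `x_n = b` (1.6.5.1), `n ≥ 1`. [cite: DavisRabinowitz1984, Sect. 1.6.5 (1.6.5.1)] -/
theorem unifPt_self (a b : ℝ) {n : ℕ} (hn : n ≠ 0) : unifPt a b n n = b := by
  have : (n : ℝ) ≠ 0 := Nat.cast_ne_zero.mpr hn
  unfold unifPt
  field_simp
  ring

/-- The uniform partition has constant cell length `x_{k+1} - x_k = (b - a)/n` (its norm `Δ`).
[cite: DavisRabinowitz1984, Sect. 1.6.5 (1.6.5.1)] -/
theorem unifPt_succ_sub (a b : ℝ) (n k : ℕ) : unifPt a b n (k + 1) - unifPt a b n k = (b - a) / n := by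
  unfold unifPt
  push_cast
  ring

/-- The uniform partition points increase: `x_j ≤ x_k` for `j ≤ k` (`a ≤ b`).
[cite: DavisRabinowitz1984, Sect. 1.6.5 (1.6.5.1)] -/
theorem unifPt_mono (a b : ℝ) (hab : a ≤ b) (n : ℕ) {j k : ℕ} (hjk : j ≤ k) :
    unifPt a b n j ≤ unifPt a b n k := by
  unfold unifPt
  have h : (0 : ℝ) ≤ (b - a) / n := div_nonneg (sub_nonneg.mpr hab) (Nat.cast_nonneg n)
  have : (j : ℝ) ≤ k := Nat.cast_le.mpr hjk
  nlinarith

/-- The uniform partition points lie in `[a, b]`: `a = x_0 ≤ x_k ≤ x_n = b` for `k ≤ n` (1.6.5.1).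
[cite: DavisRabinowitz1984, Sect. 1.6.5 (1.6.5.1)] -/
theorem unifPt_mem_Icc (a b : ℝ) (hab : a ≤ b) {n k : ℕ} (hk : k ≤ n) :
    unifPt a b n k ∈ Set.Icc a b := by
  rcases Nat.eq_zero_or_pos n with rfl | hn
  · simp [unifPt, hab]
  · refine ⟨?_, ?_⟩
    · simpa using unifPt_mono a b hab n (Nat.zero_le k)
    · simpa [unifPt_self a b hn.ne'] using unifPt_mono a b hab n hk

/-- For an integrator with a derivative `g'` on `[a, b]`, integrable on `[a, b]`, each increment is
`g(x_{k+1}) - g(x_k) = ∫_{x_k}^{x_{k+1}} g'` (fundamental theorem of calculus), so the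
Riemann–Stieltjes sum is `Σ_k f(ξ_k) ∫_{x_k}^{x_{k+1}} g'`.
[cite: DavisRabinowitz1984, Sect. 1.6.5 (1.6.5.10)] -/
theorem rsSum_eq_sum_mul_integral_deriv {f g g' : ℝ → ℝ} {a b : ℝ} (hab : a ≤ b) {n : ℕ}
    (hg : ∀ t ∈ Set.Icc a b, HasDerivAt g (g' t) t) (hg' : IntervalIntegrable g' volume a b)
    (ξ : ℕ → ℝ) :
    rsSum f g n (unifPt a b n) ξ =
      ∑ k ∈ Finset.range n, f (ξ k) * ∫ t in unifPt a b n k..unifPt a b n (k + 1), g' t := by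
  unfold rsSum
  refine Finset.sum_congr rfl fun k hk => ?_
  rw [Finset.mem_range] at hk
  have hk0 := unifPt_mem_Icc a b hab hk.le
  have hk1 := unifPt_mem_Icc a b hab (Nat.succ_le_of_lt hk)
  have hle : unifPt a b n k ≤ unifPt a b n (k + 1) := unifPt_mono a b hab n (Nat.le_succ k)
  have hsub : Set.uIcc (unifPt a b n k) (unifPt a b n (k + 1)) ⊆ Set.Icc a b := by
    rw [Set.uIcc_of_le hle]; exact Set.Icc_subset_Icc hk0.1 hk1.2
  rw [intervalIntegral.integral_eq_sub_of_hasDerivAt (fun t ht => hg t (hsub ht))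
    ((hg'.mono_set (by rw [Set.uIcc_of_le hab]; exact hsub)))]

/-- The modulus estimate behind (1.6.5.10): if `|f(s) - f(t)| ≤ E` whenever `s, t ∈ [a, b]`,
`|s - t| ≤ (b - a)/n`, and `|g'| ≤ G` on `[a, b]` (`g'` the derivative of `g`, continuous on `[a, b]`,
`f` continuous on `[a, b]`), then for `n ≥ 1` and tags `ξ_k ∈ [x_k, x_{k+1}]`,
`|S_n - ∫_a^b f g'| ≤ (b - a) G E`. [cite: DavisRabinowitz1984, Sect. 1.6.5 (1.6.5.10)] -/
theorem abs_rsSum_sub_integral_le {f g g' : ℝ → ℝ} {a b : ℝ} (hab : a ≤ b) {n : ℕ} (hn : n ≠ 0)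
    (hf : ContinuousOn f (Set.Icc a b))
    (hg : ∀ t ∈ Set.Icc a b, HasDerivAt g (g' t) t) (hg' : ContinuousOn g' (Set.Icc a b))
    {G E : ℝ} (hG : ∀ t ∈ Set.Icc a b, |g' t| ≤ G)
    (hE : ∀ s ∈ Set.Icc a b, ∀ t ∈ Set.Icc a b, |s - t| ≤ (b - a) / n → |f s - f t| ≤ E)
    (ξ : ℕ → ℝ) (hξ : ∀ k < n, ξ k ∈ Set.Icc (unifPt a b n k) (unifPt a b n (k + 1))) :
    |rsSum f g n (unifPt a b n) ξ - ∫ t in a..b, f t * g' t| ≤ (b - a) * G * E := by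
  set x := unifPt a b n with hx
  have hmem : ∀ k ≤ n, x k ∈ Set.Icc a b := fun k hk => unifPt_mem_Icc a b hab hk
  have hle : ∀ k, x k ≤ x (k + 1) := fun k => unifPt_mono a b hab n (Nat.le_succ k)
  have hsub : ∀ k < n, Set.Icc (x k) (x (k + 1)) ⊆ Set.Icc a b := fun k hk =>
    Set.Icc_subset_Icc (hmem k hk.le).1 (hmem (k + 1) (Nat.succ_le_of_lt hk)).2
  have hfg : ContinuousOn (fun t => f t * g' t) (Set.Icc a b) := hf.mul hg'
  -- split the integral over the cells
  have hint : ∀ k < n, IntervalIntegrable (fun t => f t * g' t) volume (x k) (x (k + 1)) :=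
    fun k hk => (hfg.mono (hsub k hk)).intervalIntegrable_of_Icc (hle k)
  have hsplit : ∫ t in a..b, f t * g' t = ∑ k ∈ Finset.range n, ∫ t in x k..x (k + 1), f t * g' t := by
    rw [intervalIntegral.sum_integral_adjacent_intervals hint]
    simp [hx, unifPt_self a b hn]
  have hrs := rsSum_eq_sum_mul_integral_deriv (f := f) (n := n) hab hg
    (hg'.intervalIntegrable_of_Icc hab) ξ
  rw [hrs, hsplit, ← Finset.sum_sub_distrib]
  -- each cell contributes at most ((b - a)/n) G E
  have hcell : ∀ k ∈ Finset.range n,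
      |f (ξ k) * (∫ t in x k..x (k + 1), g' t) - ∫ t in x k..x (k + 1), f t * g' t| ≤
        G * E * ((b - a) / n) := by
    intro k hk
    rw [Finset.mem_range] at hk
    have hgi : IntervalIntegrable g' volume (x k) (x (k + 1)) :=
      ((hg'.mono (hsub k hk)).intervalIntegrable_of_Icc (hle k))
    rw [← intervalIntegral.integral_const_mul, ← intervalIntegral.integral_sub (hgi.const_mul _)
      (hint k hk)]
    have hbound : ∀ t ∈ Ι (x k) (x (k + 1)), ‖f (ξ k) * g' t - f t * g' t‖ ≤ G * E := by
      intro t ht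
      rw [Set.uIoc_of_le (hle k)] at ht
      have ht' : t ∈ Set.Icc (x k) (x (k + 1)) := ⟨ht.1.le, ht.2⟩
      have htab := hsub k hk ht'
      have hξab := hsub k hk (hξ k hk)
      rw [Real.norm_eq_abs, ← sub_mul, abs_mul]
      have h1 : |f (ξ k) - f t| ≤ E := by
        refine hE _ hξab _ htab ?_
        rw [← unifPt_succ_sub a b n k]
        rw [abs_le]
        constructor <;> linarith [(hξ k hk).1, (hξ k hk).2, ht'.1, ht'.2]
      have h2 : |g' t| ≤ G := hG t htab
      calc |f (ξ k) - f t| * |g' t| ≤ E * G :=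
            mul_le_mul h1 h2 (abs_nonneg _) ((abs_nonneg _).trans h1)
        _ = G * E := mul_comm _ _
    have := intervalIntegral.norm_integral_le_of_norm_le_const hbound
    rw [Real.norm_eq_abs, unifPt_succ_sub, abs_of_nonneg (div_nonneg (sub_nonneg.mpr hab)
      (Nat.cast_nonneg n))] at this
    exact this
  refine (Finset.abs_sum_le_sum_abs _ _).trans ((Finset.sum_le_sum hcell).trans ?_)
  rw [Finset.sum_const, Finset.card_range, nsmul_eq_mul]
  have hn' : (n : ℝ) ≠ 0 := Nat.cast_ne_zero.mpr hn
  field_simp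
  ring_nf
  rfl

/-- (1.6.5.10): *if `f ∈ C[a, b]` and `g ∈ C¹[a, b]`, then `∫_a^b f dg = ∫_a^b f g' dx`* — the
Riemann–Stieltjes sums over the uniform partitions `x_k = a + k (b - a)/n` with arbitrary tags
`ξ_{n,k} ∈ [x_k, x_{k+1}]` converge to the ordinary integral `∫_a^b f g'`.
[cite: DavisRabinowitz1984, Sect. 1.6.5 (1.6.5.10)] -/
theorem tendsto_rsSum_uniform {f g g' : ℝ → ℝ} {a b : ℝ} (hab : a ≤ b)
    (hf : ContinuousOn f (Set.Icc a b))
    (hg : ∀ t ∈ Set.Icc a b, HasDerivAt g (g' t) t) (hg' : ContinuousOn g' (Set.Icc a b))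
    (ξ : ℕ → ℕ → ℝ) (hξ : ∀ n, ∀ k < n, ξ n k ∈ Set.Icc (unifPt a b n k) (unifPt a b n (k + 1))) :
    Tendsto (fun n => rsSum f g n (unifPt a b n) (ξ n)) atTop (𝓝 (∫ t in a..b, f t * g' t)) := by
  rw [Metric.tendsto_atTop]
  intro ε hε
  -- a bound for |g'| on [a, b]
  obtain ⟨G0, hG0⟩ := isCompact_Icc.exists_bound_of_continuousOn hg'
  set G := max G0 0 with hGdef
  have hG : ∀ t ∈ Set.Icc a b, |g' t| ≤ G := fun t ht =>
    (Real.norm_eq_abs _ ▸ hG0 t ht).trans (le_max_left _ _)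
  have hGnn : 0 ≤ G := le_max_right _ _
  -- uniform continuity of f on [a, b]
  set E := ε / (2 * ((b - a) * G + 1)) with hEdef
  have hden : 0 < (b - a) * G + 1 := by nlinarith [sub_nonneg.mpr hab]
  have hEpos : 0 < E := by positivity
  have huc := isCompact_Icc.uniformContinuousOn_of_continuous hf
  rw [Metric.uniformContinuousOn_iff] at huc
  obtain ⟨δ, hδ, hδE⟩ := huc E hEpos
  -- choose N with (b - a)/N < δ
  obtain ⟨N, hN⟩ := exists_nat_gt ((b - a) / δ)
  refine ⟨max N 1, fun n hn => ?_⟩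
  have hn1 : 1 ≤ n := le_of_max_le_right hn
  have hnN : N ≤ n := le_of_max_le_left hn
  have hn0 : n ≠ 0 := by omega
  have hnpos : (0 : ℝ) < n := Nat.cast_pos.mpr (by omega)
  have hmesh : (b - a) / n < δ := by
    rw [div_lt_iff₀ hnpos]
    have : (b - a) / δ < n := hN.trans_le (Nat.cast_le.mpr hnN)
    rw [div_lt_iff₀ hδ] at this
    linarith [mul_comm δ (n : ℝ)]
  have hE : ∀ s ∈ Set.Icc a b, ∀ t ∈ Set.Icc a b, |s - t| ≤ (b - a) / n → |f s - f t| ≤ E := by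
    intro s hs t ht hst
    have := hδE s hs t ht (by rw [Real.dist_eq]; exact hst.trans_lt hmesh)
    rw [Real.dist_eq] at this
    exact this.le
  have hmain := abs_rsSum_sub_integral_le hab hn0 hf hg hg' hG hE (ξ n) (hξ n)
  rw [Real.dist_eq]
  calc |rsSum f g n (unifPt a b n) (ξ n) - ∫ t in a..b, f t * g' t| ≤ (b - a) * G * E := hmain
    _ < ε := by
      rw [hEdef]
      have h1 : (b - a) * G < (b - a) * G + 1 := lt_add_one _
      have h2 : (b - a) * G * (ε / (2 * ((b - a) * G + 1))) ≤ ε / 2 := by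
        rw [show (b - a) * G * (ε / (2 * ((b - a) * G + 1))) =
          (ε / 2) * ((b - a) * G / ((b - a) * G + 1)) by field_simp]
        have : (b - a) * G / ((b - a) * G + 1) ≤ 1 := by
          rw [div_le_one hden]; exact h1.le
        nlinarith
      linarith

/-- (1.6.5.11): *if `w(t) ≥ 0`, `∫_a^b w < ∞`, and `g(x) = ∫_a^x w(t) dt`, then the Riemann–Stieltjes
integral reduces to the weighted Riemann integral `∫_a^b f dg = ∫_a^b w f dx`* — here for `w`
continuous on `[a, b]` (the sign of `w` plays no role): the sums for the integrator
`g(x) = ∫_a^x w` over the uniform partitions converge to `∫_a^b w f`.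
[cite: DavisRabinowitz1984, Sect. 1.6.5 (1.6.5.11)] -/
theorem tendsto_rsSum_primitive {f w : ℝ → ℝ} {a b : ℝ} (hab : a ≤ b)
    (hf : ContinuousOn f (Set.Icc a b)) (hw : Continuous w)
    (ξ : ℕ → ℕ → ℝ) (hξ : ∀ n, ∀ k < n, ξ n k ∈ Set.Icc (unifPt a b n k) (unifPt a b n (k + 1))) :
    Tendsto (fun n => rsSum f (fun x => ∫ t in a..x, w t) n (unifPt a b n) (ξ n)) atTop
      (𝓝 (∫ t in a..b, w t * f t)) := by
  have hg : ∀ t ∈ Set.Icc a b, HasDerivAt (fun x => ∫ s in a..x, w s) (w t) t := fun t _ =>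
    intervalIntegral.integral_hasDerivAt_right (hw.intervalIntegrable _ _)
      (hw.stronglyMeasurableAtFilter _ _) hw.continuousAt
  have h := tendsto_rsSum_uniform hab hf hg hw.continuousOn ξ hξ
  simpa [mul_comm] using h

/-- The increments of the integrator `g(x) = ∫_a^x w` are the cell integrals of the weight:
`g(x_{k+1}) - g(x_k) = ∫_{x_k}^{x_{k+1}} w`, so the Riemann–Stieltjes sum for `dg` is the
product-type sum `Σ_k f(ξ_k) ∫_{x_k}^{x_{k+1}} w`. [cite: DavisRabinowitz1984, Sect. 1.6.5 (1.6.5.11)] -/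
theorem rsSum_primitive_eq {f w : ℝ → ℝ} {a : ℝ} (hw : Continuous w) (n : ℕ) (x ξ : ℕ → ℝ) :
    rsSum f (fun y => ∫ t in a..y, w t) n x ξ =
      ∑ k ∈ Finset.range n, f (ξ k) * ∫ t in x k..x (k + 1), w t := by
  unfold rsSum
  refine Finset.sum_congr rfl fun k _ => ?_
  rw [intervalIntegral.integral_interval_sub_left (hw.intervalIntegrable _ _)
    (hw.intervalIntegrable _ _)]

end Literature.Analysis.Quadrature
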